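import Mathlib
import Summits.HodgeConjecture.HodgeConjecture.Theorems.PadicSemiregularLiftHodgeAbelianVarietiesAndrePowerHOne
import Literature.AlgebraicGeometry.HodgeTheory.WeilFamilyReachOfPeriodConstruction

/-!
# Crux `HodgeAbelianVarieties` (stmt-HodgeConjecture-1333), line `cm-pivot-andre` — André with CM targets, module L2b: the idempotent endomorphisms `u_α`

Given two endomorphisms `X, Y` of a complex abelian variety `B` acting diagonally on a basis `𝔅(λ, s)` of
`H¹(B(ℂ); ℂ)` with eigenvalues `μ_λ`, `ρ_s` (module L2a for `B = A ⊗ O_E`), and the rational Lagrange data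
`c j k l`, `e s` of module L1 (key identity `Σ_{k,l} c j k l μ_λ^k ρ_s^l = [λ = e s j]`), this module builds, for
every set `α` of eigenvalue indices, the endomorphism `u_α = Σ_{j∈α} Σ_{k,l} (N c j k l) • (X^k ≫ Y^l)` (`N` a common
denominator) and proves: `u_α^* 𝔅(λ,s) = N·[e_s⁻¹ λ ∈ α] 𝔅(λ,s)`, `u_α` commutes with `X` and `Y`, `u_α² = N u_α`,
and `2 dim (im u_α) = |α| · n` (`work/andre/PLAN.md` §4). The images `im u_α`, `|α| = 2p`, are André's targets.
-/

set_option linter.dupNamespace false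

noncomputable section

namespace Summit.HodgeConjecture.HodgeConjecture.Theorems.HodgeAbelianVarieties.CMPivotAndre

open CategoryTheory
open Literature.AlgebraicGeometry Literature.AlgebraicGeometry.Motives Literature.AlgebraicGeometry.HodgeTheory

/-- **André's idempotents.** For endomorphisms `X, Y` of `B` diagonal on a basis `𝔅(λ,s)` of `H¹(B(ℂ); ℂ)`
(eigenvalues `μ_λ`, `ρ_s`) and rational data `c`, `e` with `Σ_{k,l} c j k l μ_λ^k ρ_s^l = [λ = e s j]`, there are
`N ≥ 1` and endomorphisms `u_α` (`α` a finite set of indices `λ`) with `u_α^* 𝔅(λ,s) = N·[e_s⁻¹ λ ∈ α]·𝔅(λ,s)`,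
`u_α ≫ X = X ≫ u_α`, `u_α ≫ Y = Y ≫ u_α`, `u_α ≫ u_α = N • u_α` and `2 dim (im u_α) = |α| n`.
[cite: Andre1992HodgeCM, Théorème] [cite: LangeBirkenhake1992, §1.1 Prop. 1.1.6 and Prop. 1.1.10] -/
theorem exists_andreIdempotents : ∀ {N n : ℕ} (B : Literature.AlgebraicGeometry.Motives.AbelianVariety ℂ) (X Y : B ⟶ B) (𝔅 : Module.Basis (Fin N × Fin n) ℂ (Literature.AlgebraicGeometry.HodgeTheory.complexBetti B.X 1)) (μ : Fin N → ℂ) (ρ : Fin n → ℂ), (∀ l s, Literature.AlgebraicGeometry.HodgeTheory.complexBetti.map X.hom.hom.hom 1 (𝔅 (l, s)) = μ l • 𝔅 (l, s)) → (∀ l s, Literature.AlgebraicGeometry.HodgeTheory.complexBetti.map Y.hom.hom.hom 1 (𝔅 (l, s)) = ρ s • 𝔅 (l, s)) → ∀ (e : Fin n → Equiv.Perm (Fin N)) (c : Fin N → Fin N → Fin n → ℚ), (∀ s j l', ∑ k, ∑ l, (c j k l : ℂ) * μ l' ^ (k : ℕ) * ρ s ^ (l : ℕ) = if l' = e s j then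 1 else 0) → ∃ (Nd : ℕ) (u : Finset (Fin N) → (B ⟶ B)), 0 < Nd ∧ (∀ α l s, Literature.AlgebraicGeometry.HodgeTheory.complexBetti.map (u α).hom.hom.hom 1 (𝔅 (l, s)) = (if (e s).symm l ∈ α then (Nd : ℂ) else 0) • 𝔅 (l, s)) ∧ (∀ α, u α ≫ X = X ≫ u α) ∧ (∀ α, u α ≫ Y = Y ≫ u α) ∧ (∀ α, u α ≫ u α = Nd • u α) ∧ (∀ α, 2 * (Literature.AlgebraicGeometry.Motives.AbelianVariety.image (u α)).dim = α.card * n) := by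
  intro N n B X Y 𝔅 μ ρ hX hY e c hkey
  classical
  haveI := finite_complexBetti_abelianVariety B 1
  -- a common denominator `Nd` of the `c j k l` and the integers `z j k l = Nd * c j k l`
  let Nd : ℕ := ∏ j : Fin N, ∏ k : Fin N, ∏ l : Fin n, (c j k l).den
  have hNd_pos : 0 < Nd := by
    refine Finset.prod_pos fun j _ => Finset.prod_pos fun k _ => Finset.prod_pos fun l _ => ?_
    exact (c j k l).den_pos
  have hden_dvd : ∀ j k l, (c j k l).den ∣ Nd := by
    intro j k l
    refine dvd_trans ?_ (Finset.dvd_prod_of_mem _ (Finset.mem_univ j))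
    refine dvd_trans ?_ (Finset.dvd_prod_of_mem _ (Finset.mem_univ k))
    exact Finset.dvd_prod_of_mem _ (Finset.mem_univ l)
  have hz : ∀ j k l, ∃ z : ℤ, (z : ℂ) = (Nd : ℂ) * (c j k l : ℂ) := by
    intro j k l
    obtain ⟨d, hd⟩ := hden_dvd j k l
    refine ⟨d * (c j k l).num, ?_⟩
    have hq : ((c j k l : ℚ) : ℂ) = ((c j k l).num : ℂ) / ((c j k l).den : ℂ) := by
      rw [← Rat.cast_intCast, ← Rat.cast_natCast, ← Rat.cast_div, Rat.num_div_den]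
    have hden0 : ((c j k l).den : ℂ) ≠ 0 := Nat.cast_ne_zero.mpr (c j k l).den_pos.ne'
    rw [hq, hd]
    push_cast
    field_simp
  choose z hzc using hz
  -- powers of `X` and `Y` and their action on `𝔅`
  let Xp : ℕ → (B ⟶ B) := fun k => Nat.rec (𝟙 B) (fun _ f => f ≫ X) k
  let Yp : ℕ → (B ⟶ B) := fun k => Nat.rec (𝟙 B) (fun _ f => f ≫ Y) k
  have hXp0 : Xp 0 = 𝟙 B := rfl
  have hXps : ∀ k, Xp (k + 1) = Xp k ≫ X := fun k => rfl
  have hYp0 : Yp 0 = 𝟙 B := rfl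
  have hYps : ∀ k, Yp (k + 1) = Yp k ≫ Y := fun k => rfl
  have hXp : ∀ (k : ℕ) l s, complexBetti.map (Xp k).hom.hom.hom 1 (𝔅 (l, s)) = μ l ^ k • 𝔅 (l, s) := by
    intro k l s
    induction k with
    | zero => rw [hXp0, complexBetti_map_id_one_apply, pow_zero, one_smul]
    | succ k ih =>
      rw [hXps, ← complexBetti_map_map_one_apply, hX, map_smul, ih, smul_smul, pow_succ, mul_comm]
  have hYp : ∀ (k : ℕ) l s, complexBetti.map (Yp k).hom.hom.hom 1 (𝔅 (l, s)) = ρ s ^ k • 𝔅 (l, s) := by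
    intro k l s
    induction k with
    | zero => rw [hYp0, complexBetti_map_id_one_apply, pow_zero, one_smul]
    | succ k ih =>
      rw [hYps, ← complexBetti_map_map_one_apply, hY, map_smul, ih, smul_smul, pow_succ, mul_comm]
  have hXY𝔅 : ∀ (k l' : ℕ) l s, complexBetti.map (Xp k ≫ Yp l').hom.hom.hom 1 (𝔅 (l, s)) =
      (μ l ^ k * ρ s ^ l') • 𝔅 (l, s) := by
    intro k l' l s
    rw [← complexBetti_map_map_one_apply, hYp, map_smul, hXp, smul_smul, mul_comm]
  -- the endomorphisms `u_α`
  let u : Finset (Fin N) → (B ⟶ B) := fun α =>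
    ∑ j ∈ α, ∑ k : Fin N, ∑ l : Fin n, z j k l • (Xp k ≫ Yp l)
  -- sum / faithfulness helpers
  have hsum : ∀ {J : Type} (S : Finset J) (f : J → (B ⟶ B)) (x : complexBetti B.X 1),
      complexBetti.map (∑ j ∈ S, f j).hom.hom.hom 1 x = ∑ j ∈ S, complexBetti.map (f j).hom.hom.hom 1 x := by
    intro J S f x
    rw [complexBetti_map_finsetSum_one]
    change (∑ j ∈ S, complexBetti.map (f j).hom.hom.hom 1).hom x = _
    rw [ModuleCat.hom_sum, LinearMap.coe_sum, Finset.sum_apply]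
  have hfaith : ∀ f g : B ⟶ B, (∀ l s, complexBetti.map f.hom.hom.hom 1 (𝔅 (l, s)) =
      complexBetti.map g.hom.hom.hom 1 (𝔅 (l, s))) → f = g := by
    intro f g hfg
    apply AbelianVariety.hom_eq_of_complexBetti_map_one_eq
    ext1
    apply 𝔅.ext
    rintro ⟨l, s⟩
    exact hfg l s
  -- their diagonal action on `𝔅`
  have hu𝔅 : ∀ α l s, complexBetti.map (u α).hom.hom.hom 1 (𝔅 (l, s)) =
      (if (e s).symm l ∈ α then (Nd : ℂ) else 0) • 𝔅 (l, s) := by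
    intro α l s
    have hterm : ∀ j (k : Fin N) (l' : Fin n), complexBetti.map (z j k l' • (Xp k ≫ Yp l')).hom.hom.hom 1 (𝔅 (l, s)) =
        ((Nd : ℂ) * ((c j k l' : ℂ) * μ l ^ (k : ℕ) * ρ s ^ (l' : ℕ))) • 𝔅 (l, s) := by
      intro j k l'
      rw [complexBetti_map_zsmul_one]
      change (z j k l' • complexBetti.map (Xp k ≫ Yp l').hom.hom.hom 1).hom (𝔅 (l, s)) = _
      rw [ModuleCat.hom_zsmul, LinearMap.smul_apply]
      change z j k l' • complexBetti.map (Xp k ≫ Yp l').hom.hom.hom 1 (𝔅 (l, s)) = _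
      rw [hXY𝔅, ← Int.cast_smul_eq_zsmul ℂ, smul_smul, hzc]
      congr 1
      ring
    show complexBetti.map (∑ j ∈ α, ∑ k : Fin N, ∑ l : Fin n, z j k l • (Xp k ≫ Yp l)).hom.hom.hom 1 (𝔅 (l, s)) = _
    simp_rw [hsum, hterm, ← Finset.sum_smul]
    congr 1
    simp_rw [← Finset.mul_sum, hkey]
    have hcond : ∀ j, (l = e s j) ↔ ((e s).symm l = j) := fun j => (Equiv.symm_apply_eq (e s)).symm
    simp_rw [hcond, Finset.sum_ite_eq, mul_ite, mul_one, mul_zero]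
  -- commutation with `X`, `Y` and `u_α² = Nd u_α`, by faithfulness of `H¹`
  have huX : ∀ α, u α ≫ X = X ≫ u α := by
    intro α
    apply hfaith
    intro l s
    rw [← complexBetti_map_map_one_apply, hX, map_smul, hu𝔅, ← complexBetti_map_map_one_apply, hu𝔅,
      map_smul, hX, smul_comm]
  have huY : ∀ α, u α ≫ Y = Y ≫ u α := by
    intro α
    apply hfaith
    intro l s
    rw [← complexBetti_map_map_one_apply, hY, map_smul, hu𝔅, ← complexBetti_map_map_one_apply, hu𝔅,
      map_smul, hY, smul_comm]
  have huu : ∀ α, u α ≫ u α = Nd • u α := by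
    intro α
    apply hfaith
    intro l s
    rw [← complexBetti_map_map_one_apply, hu𝔅, map_smul, hu𝔅, smul_smul, complexBetti_map_nsmul_one]
    change _ = (Nd • complexBetti.map (u α).hom.hom.hom 1).hom (𝔅 (l, s))
    rw [ModuleCat.hom_nsmul, LinearMap.smul_apply]
    change _ = Nd • complexBetti.map (u α).hom.hom.hom 1 (𝔅 (l, s))
    rw [hu𝔅, ← Nat.cast_smul_eq_nsmul ℂ, smul_smul]
    congr 1
    split_ifs <;> ring
  -- `2 dim (im u_α) = |α| · n`: the rank of the diagonal operator `u_α^*`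
  have hdim : ∀ α, 2 * (AbelianVariety.image (u α)).dim = α.card * n := by
    intro α
    rw [← finrank_range_complexBetti_map_one (u α)]
    let S : Finset (Fin N × Fin n) := Finset.univ.filter fun ls => (e ls.2).symm ls.1 ∈ α
    have hmemS : ∀ ls : Fin N × Fin n, ls ∈ S ↔ (e ls.2).symm ls.1 ∈ α := fun ls => by simp [S]
    have hL : ∀ ls : Fin N × Fin n, (complexBetti.map (u α).hom.hom.hom 1).hom (𝔅 ls) =
        (if (e ls.2).symm ls.1 ∈ α then (Nd : ℂ) else 0) • 𝔅 ls := by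
      rintro ⟨l, s⟩
      exact hu𝔅 α l s
    have hrange : LinearMap.range (complexBetti.map (u α).hom.hom.hom 1).hom =
        Submodule.span ℂ (Set.range fun i : S => 𝔅 i) := by
      apply le_antisymm
      · rintro _ ⟨x, rfl⟩
        rw [← 𝔅.sum_repr x, map_sum]
        refine Submodule.sum_mem _ fun ls _ => ?_
        rw [map_smul, hL]
        by_cases h : (e ls.2).symm ls.1 ∈ α
        · rw [if_pos h]
          exact Submodule.smul_mem _ _ (Submodule.smul_mem _ _
            (Submodule.subset_span ⟨⟨ls, (hmemS ls).mpr h⟩, rfl⟩))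
        · rw [if_neg h, zero_smul, smul_zero]
          exact Submodule.zero_mem _
      · rw [Submodule.span_le]
        rintro _ ⟨⟨ls, hls⟩, rfl⟩
        have h : (e ls.2).symm ls.1 ∈ α := (hmemS ls).mp hls
        refine ⟨(Nd : ℂ)⁻¹ • 𝔅 ls, ?_⟩
        rw [map_smul, hL, if_pos h, smul_smul, inv_mul_cancel₀ (Nat.cast_ne_zero.mpr hNd_pos.ne'), one_smul]
    have hcardS : S.card = α.card * n := by
      have : S.card = (α ×ˢ (Finset.univ : Finset (Fin n))).card := by
        refine Finset.card_bij (fun ls _ => ((e ls.2).symm ls.1, ls.2)) ?_ ?_ ?_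
        · intro ls hls
          exact Finset.mem_product.mpr ⟨(hmemS ls).mp hls, Finset.mem_univ _⟩
        · rintro ⟨l₁, s₁⟩ h₁ ⟨l₂, s₂⟩ h₂ h
          simp only [Prod.mk.injEq] at h
          obtain ⟨h1, rfl⟩ := h
          simp only [Prod.mk.injEq, and_true]
          exact (e s₁).symm.injective h1
        · rintro ⟨j, s⟩ hjs
          refine ⟨(e s j, s), (hmemS _).mpr ?_, ?_⟩
          · simpa [Equiv.symm_apply_apply] using (Finset.mem_product.mp hjs).1
          · simp
      rw [this, Finset.card_product, Finset.card_univ, Fintype.card_fin]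
    rw [hrange, finrank_span_eq_card, Fintype.card_coe, hcardS]
    exact 𝔅.linearIndependent.comp (fun i : S => (i : Fin N × Fin n)) Subtype.val_injective
  exact ⟨Nd, u, hNd_pos, hu𝔅, huX, huY, huu, hdim⟩

end Summit.HodgeConjecture.HodgeConjecture.Theorems.HodgeAbelianVarieties.CMPivotAndre

end
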